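import Literature.AnabelianGeometry.EtaleTheta.Discharge.Sec5Thm57CoherentFamilyOfRebaseAnchoredIso

/-!
# [EtTh] §5, Theorem 5.7 final knit — FILE 2 (anchored, r4) with the per-anchor binders restricted to CONSTANT discrepancy units
# (pp. 318–319, 329–331 / PDF pp. 92–93, 103–105)

Mochizuki, *The étale theta function …*, Publ. RIMS **45** (2009) [cite: MochizukiEtTh2009, Thm 5.7 p.330 (PDF p.104); Rmk 4.3.2
p.318–319 (PDF pp.92–93); Prop 4.2 (iv) p.315 (PDF p.89); Lem 5.8 p.331 (PDF p.105); Def 3.6 (iii) p.303 (PDF p.77)].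
abc-iut cell, layer L2, node `EtTh:Thm5.7`; abc-iut-L2-lead (gen 5) R719 «HCFIX@PRODUCED-ANCHOR» file (b) (seat abc-iut-f-123 gen 6).
PROOF-ONLY twin (0 definitions, 0 new named facts; nothing landed is edited or restated) of abc-iut-w6-d077's
`Discharge/Sec5Thm57CoherentFamilyOfRebaseAnchoredIso.lean` (FILE 2, r4: `hfam_of_rebase_anchored_iso`,
`hfam_ofConnectedTemperoidFamily_of_rebase_anchored_iso`): the SAME proof, with the three per-anchor binders `hf` (Thm. 4.4 (ii)
compatibility), `hroot` (the root clause: Lemma 5.8 + Def. 4.1 (iii) at the twisted fraction) and `hivPiso` (Prop. 4.2 (iv) across the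
anchor) — and the conclusion — quantified only over normalised anchors `(α₁, β₁, u₁)` whose discrepancy unit is a NAMED base-curve
CONSTANT: `(c : K'ˣ) (hux : u_{u₁} = (t 1)^*(c₀ c))` (root-data form) / `(c : T.Kˣ) (hcst : unitsToBirat u₁ = constEmb 1 c)` (tower
form; `congrArg Units.val` converts).  Legitimate because the capstone consumes the family at ONE anchor, PRODUCED at the first root,
whose discrepancy unit IS a constant (`Sec5Thm57AnchoredFamilyConstAnchor.lean`, `exists_const_of_normalisedAnchor`); the point is that
at a constant anchor the root clause's fixedness half (Def. 3.6 (iii)) and Lemma-5.8 half become theorems / print-verbatim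
(`Sec5Thm57FinalKnitV5.lean`).
HONEST FRAMING: kernel-checked composition of landed theorems for data so parametrised (no instance of
`TemperedFrobenioid T₀ (ConnectedPart (BTemp X.Pi)) VD` for an actual curve is constructed here); nothing asserts any result of [EtTh]
unconditionally; typed ≠ discharged — PROVED modulo the displayed binders; no side taken on anything downstream ([IUTchIII] Cor. 3.12 in
particular).
-/

noncomputable section

namespace Literature.AnabelianGeometry.EtaleTheta

open CategoryTheory Opposite Literature.AlgebraicGeometry.Frobenioids Literature.AnabelianGeometry.SemiGraphs
  Literature.AnabelianGeometry.SemiGraphs.GaloisObjects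

universe u₀ v₀ w

namespace ThetaFrobenioidTower

variable {K : Type u₀} [Field K] {X : SemiGraphs.TemperedArithmeticGroup.{u₀} K} {D₀ : Type u₀} [Category.{v₀} D₀]
  {V : FrdIMonoidStub.{w}} {T₀ : RealifiedDivisorMonoids (D₀ := D₀) V}
  {VD : FrdICatStub.{u₀ + 1, u₀, w} (ConnectedPart (BTemp X.Pi))}
  {tf : TemperedFrobenioid T₀ (ConnectedPart (BTemp X.Pi)) VD} {hZ : tf.monoidType = MonoidType.Z}
  {hP : ∀ A : (ConnectedPart (BTemp X.Pi))ᵒᵖ, IsPerfect (tf.Φ.carrier A)}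
  {NH : Subgroup (Field.absoluteGaloisGroup K) → tf.category → ℕ+ → Prop}
  {E : Set ℕ+} (𝒯 : ThetaEnvTower.{max u₀ w} E) (ιX : 𝒯.PiX ≃ₜ* X.Pi)
  {pullFrac : ∀ {A A' : (BiKummerSetting.mkOfConnectedTemperoidYddTower X tf hZ hP NH 𝒯 ιX).C} (_ : A' ⟶ A),
    (BiKummerSetting.mkOfConnectedTemperoidYddTower X tf hZ hP NH 𝒯 ιX).biratUnits A →
      (BiKummerSetting.mkOfConnectedTemperoidYddTower X tf hZ hP NH 𝒯 ιX).biratUnits A'}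
  {lv : ℕ+}
  {θ : (BiKummerSetting.mkOfConnectedTemperoidYddTower X tf hZ hP NH 𝒯 ιX).biratUnits
    (BiKummerSetting.mkOfConnectedTemperoidYddTower X tf hZ hP NH 𝒯 ιX).Aodot}
  {Bl : (BiKummerSetting.mkOfConnectedTemperoidYddTower X tf hZ hP NH 𝒯 ιX).C}
  {Pl : (BiKummerSetting.mkOfConnectedTemperoidYddTower X tf hZ hP NH 𝒯 ιX).FractionPair θ Bl}
  {Rl : (BiKummerSetting.mkOfConnectedTemperoidYddTower X tf hZ hP NH 𝒯 ιX).NthRoot θ Pl lv pullFrac}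
  (h : ModelFrobenioid.Hypotheses tf.divisorMonoid tf.ratFnFunctor)
  (Q : FrobenioidTheta.ThetaSubquotientStub.{w} (ConnectedPart (BTemp X.Pi))) (odd_l : Odd (lv : ℕ))
  (R : ∀ N : ℕ+, (BiKummerSetting.mkOfConnectedTemperoidYddTower X tf hZ hP NH 𝒯 ιX).NthRoot Rl.root Rl.pair N pullFrac)
  (K' : Type w) [Field K'] {X₀ : ConnectedPart (BTemp X.Pi)}
  (t : ∀ N : ℕ+, (R N).BN.base ⟶ X₀)
  (c₀ : K'ˣ →* (tf.ratFnFunctor.obj (op X₀))ˣ)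
  (hinj : ∀ N : ℕ+, Function.Injective ((Units.map (tf.ratFnFunctor.map (t N).op).hom).comp c₀))
  (hinvc : ∀ (N : ℕ+) (g : Aut (R N).AN.base),
    pull tf.divisorMonoid g.hom (ModelFrobenioid.div (R N).pair.num) = ModelFrobenioid.div (R N).pair.num)
  (hinvp : ∀ (N : ℕ+) (y : 𝒯.PiX), y ∈ 𝒯.PiYdd →
    pull tf.divisorMonoid ((BiKummerSetting.mkOfConnectedTemperoidYddTower X tf hZ hP NH 𝒯 ιX).galoisSurj (R N).AN.base
      (R N).αData.isGalois (ιX y)).hom (ModelFrobenioid.div (R N).pair.den) = ModelFrobenioid.div (R N).pair.den)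
  (α : ∀ {N N' : ℕ+}, (N : ℕ) ∣ N' → ((R N').AN ⟶ (R N).AN))
  (β : ∀ {N N' : ℕ+}, (N : ℕ) ∣ N' → ((R N').BN ⟶ (R N).BN))
  (comm_sCap : ∀ {N N' : ℕ+} (hd : (N : ℕ) ∣ N'), (R N').pair.num ≫ β hd = α hd ≫ (R N).pair.num)
  (comm_sCup : ∀ {N N' : ℕ+} (hd : (N : ℕ) ∣ N'), (R N').pair.den ≫ β hd = α hd ≫ (R N).pair.den)
  (isIsometry_α : ∀ {N N' : ℕ+} (hd : (N : ℕ) ∣ N'),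
    ((BiKummerSetting.mkOfConnectedTemperoidYddTower X tf hZ hP NH 𝒯 ιX).sec5Stub h).pre.IsIsometry (α hd))
  (degFr_α : ∀ {N N' : ℕ+} (hd : (N : ℕ) ∣ N'),
    (((BiKummerSetting.mkOfConnectedTemperoidYddTower X tf hZ hP NH 𝒯 ιX).sec5Stub h).pre.degFr (α hd) : ℕ) * N = N')
  (isIsometry_β : ∀ {N N' : ℕ+} (hd : (N : ℕ) ∣ N'),
    ((BiKummerSetting.mkOfConnectedTemperoidYddTower X tf hZ hP NH 𝒯 ιX).sec5Stub h).pre.IsIsometry (β hd))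
  (degFr_β : ∀ {N N' : ℕ+} (hd : (N : ℕ) ∣ N'),
    (((BiKummerSetting.mkOfConnectedTemperoidYddTower X tf hZ hP NH 𝒯 ιX).sec5Stub h).pre.degFr (β hd) : ℕ) * N = N')
  (baseFrob_α : ∀ {N N' : ℕ+} (hd : (N : ℕ) ∣ N'),
    (BiKummerSetting.mkOfConnectedTemperoidYddTower X tf hZ hP NH 𝒯 ιX).IsOfBaseFrobeniusType (α hd))
  -- the Thm. 4.4 data of the self-equivalence `Ψ = h44.Ψ`
  (h44 : BiKummerSetting.Thm44Hyp (BiKummerSetting.mkOfConnectedTemperoidYddTower X tf hZ hP NH 𝒯 ιX)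
    (BiKummerSetting.mkOfConnectedTemperoidYddTower X tf hZ hP NH 𝒯 ιX))
  (ψ : ∀ A : (BiKummerSetting.mkOfConnectedTemperoidYddTower X tf hZ hP NH 𝒯 ιX).C,
    (BiKummerSetting.mkOfConnectedTemperoidYddTower X tf hZ hP NH 𝒯 ιX).biratUnits A ≃*
      (BiKummerSetting.mkOfConnectedTemperoidYddTower X tf hZ hP NH 𝒯 ιX).biratUnits (h44.Ψ.functor.obj A))
  (hpull : ∀ {A A' : (BiKummerSetting.mkOfConnectedTemperoidYddTower X tf hZ hP NH 𝒯 ιX).C} (φ : A' ⟶ A)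
    (f : (BiKummerSetting.mkOfConnectedTemperoidYddTower X tf hZ hP NH 𝒯 ιX).biratUnits A),
      ψ A' (pullFrac φ f) = pullFrac (h44.Ψ.functor.map φ) (ψ A f))
  (hii : BiKummerSetting.Thm44_ii h44 ψ) (h3 : h44.PreservesFrobeniusStructure) (h4b : h44.PreservesBaseFrobeniusTypeData)
  (h8 : h44.PreservesAmple) (h15a : h44.PreservesFixedByHA ψ) (h15 : h44.PreservesSaturated ψ)
  (hpull₂ : ∀ {X' Y Z : (BiKummerSetting.mkOfConnectedTemperoidYddTower X tf hZ hP NH 𝒯 ιX).C} (φ : X' ⟶ Y) (χ : Y ⟶ Z)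
    (g : (BiKummerSetting.mkOfConnectedTemperoidYddTower X tf hZ hP NH 𝒯 ιX).biratUnits Z),
      pullFrac (φ ≫ χ) g = pullFrac φ (pullFrac χ g))
  -- (B1)/(B1′): the Def. 4.1 (iv) datum of each transition `α_{1,N}` and its pull-back compatibility
  (D : ∀ N : ℕ+, (BiKummerSetting.mkOfConnectedTemperoidYddTower X tf hZ hP NH 𝒯 ιX).BaseFrobeniusTypeData (α (one_dvd_level N)))
  (hD : ∀ N : ℕ+, pullFrac (D N).α₁ (R 1).root = pullFrac (R N).αData.α₁ Rl.root)

/-- `deg_Fr(α_{1,N}) = N` from the tower's degree law `deg_Fr(α_{N,N'})·N = N'` at `(1, N)` (copy of the private lemma of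
`Sec5Thm57CoherentFamilyOfRebase.lean`). [cite: MochizukiEtTh2009, Rmk 4.3.2 p.318–319 (PDF pp.92–93)] -/
private theorem degFr_eq_of_one_const {d N : ℕ+} (hd : (d : ℕ) * ((1 : ℕ+) : ℕ) = N) : d = N := by
  rw [PNat.one_coe, mul_one] at hd
  exact PNat.coe_inj.mp hd

include comm_sCap comm_sCup isIsometry_α degFr_α isIsometry_β degFr_β hpull hii h3 h4b h8 h15a h15 hD in
/-- **CONSTANT-ANCHORED twin** (per-anchor binders `hf`, `hroot`, `hivPiso` and the conclusion restricted to normalised anchors whose discrepancy unit is a named base-curve constant `u_{u₁} = (t 1)^*(c₀ c)`; same proof) of abc-iut-w6-d077's `hfam_of_rebase_anchored_iso`: **the coherent family at the genuine setting, root-data form — ANCHORED binders, NO `hArises`** (twin of abc-iut-f-123's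
`hfam_of_rebase_anchored`): for every NORMALISED ANCHOR `(α₁, β₁, u₁)` at the first root and every level `N`, identifications
`a : Ψ(A_N) ⥲ A_N`, `b : Ψ(B_N) ⥲ B_N` and a unit `w ∈ O^×(B_N)` transporting `s^⊓_N` on the nose and `s^⊔_N` up to `w`, coherent with the anchor
along `α_{1,N}`, `β_{1,N}` — from `NthRoot.exists_coherent_family_member_rebase_iso` (Prop. 4.2 (iv) ACROSS the anchor at the rebased root and
its `Ψ`-image; the structure `w = v·ũ` of the discrepancy unit is dropped here to keep the capstone's binder shape).
[cite: MochizukiEtTh2009, Thm 5.7 p.330 (PDF p.104); Rmk 4.3.2 p.318–319 (PDF pp.92–93); Prop 4.2 (iv) p.315 (PDF p.89)] -/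
theorem hfam_of_rebase_anchored_iso_const
    -- per anchor: Thm. 4.4 (ii) birational compatibility of the anchor at `A_1` with the twisted fraction
    (hf : ∀ (α₁ : h44.Ψ.functor.obj (R 1).AN ≅ (R 1).AN) (β₁ : h44.Ψ.functor.obj (R 1).BN ≅ (R 1).BN) (u₁ : Aut (R 1).BN)
      (hu₁ : u₁ ∈ (BiKummerSetting.mkOfConnectedTemperoidYddTower X tf hZ hP NH 𝒯 ιX).units (R 1).BN),
      α₁.inv ≫ h44.Ψ.functor.map (R 1).pair.num ≫ β₁.hom = (R 1).pair.num →
      α₁.inv ≫ h44.Ψ.functor.map (R 1).pair.den ≫ β₁.hom = (R 1).pair.den ≫ u₁.hom →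
      ∀ c : K'ˣ, ModelFrobenioid.unit u₁.hom = (tf.ratFnFunctor.map (t 1).op).hom (c₀ c : tf.ratFnFunctor.obj (op X₀)) →
        pullFrac α₁.hom
          ((BiKummerSetting.mkOfConnectedTemperoidYddTower X tf hZ hP NH 𝒯 ιX).fracOf (R 1).pair.num ((R 1).pair.den ≫ u₁.hom)
            (R 1).pair.isPreStep_num
            ((BiKummerSetting.mkOfConnectedTemperoidYddTower X tf hZ hP NH 𝒯 ιX).isPreStep_comp_aut (R 1).pair.isPreStep_den u₁)
            ((BiKummerSetting.mkOfConnectedTemperoidYddTower X tf hZ hP NH 𝒯 ιX).baseEquivalent_comp_unit (R 1).pair.base_eq hu₁)) =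
          ψ (R 1).AN (R 1).root)
    -- per anchor and level: the base isomorphism of `Ψ` at `A_N` over `α_{1,N}` (⟸ «`A_N^bs` characteristic», p453958)
    (hebs : ∀ (α₁ : h44.Ψ.functor.obj (R 1).AN ≅ (R 1).AN) (N : ℕ+),
      ∃ ebs : (BiKummerSetting.mkOfConnectedTemperoidYddTower X tf hZ hP NH 𝒯 ιX).base.obj (R N).AN ≅
          (BiKummerSetting.mkOfConnectedTemperoidYddTower X tf hZ hP NH 𝒯 ιX).base.obj (h44.Ψ.functor.obj (R N).AN),
        (BiKummerSetting.mkOfConnectedTemperoidYddTower X tf hZ hP NH 𝒯 ιX).base.map (α (one_dvd_level N)) =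
          ebs.hom ≫ (BiKummerSetting.mkOfConnectedTemperoidYddTower X tf hZ hP NH 𝒯 ιX).base.map
            (h44.Ψ.functor.map (α (one_dvd_level N)) ≫ α₁.hom))
    -- per NORMALISED ANCHOR `(α₁, β₁, u₁)` and level (anchored form of abc-iut-L2-d4's `hroot₁N` with its birational clauses)
    (hroot : ∀ (α₁ : h44.Ψ.functor.obj (R 1).AN ≅ (R 1).AN) (β₁ : h44.Ψ.functor.obj (R 1).BN ≅ (R 1).BN) (u₁ : Aut (R 1).BN)
      (hu₁ : u₁ ∈ (BiKummerSetting.mkOfConnectedTemperoidYddTower X tf hZ hP NH 𝒯 ιX).units (R 1).BN),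
      α₁.inv ≫ h44.Ψ.functor.map (R 1).pair.num ≫ β₁.hom = (R 1).pair.num →
      α₁.inv ≫ h44.Ψ.functor.map (R 1).pair.den ≫ β₁.hom = (R 1).pair.den ≫ u₁.hom →
      ∀ c : K'ˣ, ModelFrobenioid.unit u₁.hom = (tf.ratFnFunctor.map (t 1).op).hom (c₀ c : tf.ratFnFunctor.obj (op X₀)) →
      ∀ (N : ℕ+), ∃ (ut : Aut (R N).BN) (hut : ut ∈ (BiKummerSetting.mkOfConnectedTemperoidYddTower X tf hZ hP NH 𝒯 ιX).units (R N).BN),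
        ut.hom ≫ β (one_dvd_level N) = β (one_dvd_level N) ≫ u₁.hom ∧
        (BiKummerSetting.mkOfConnectedTemperoidYddTower X tf hZ hP NH 𝒯 ιX).fracOf (R N).pair.num ((R N).pair.den ≫ ut.hom)
            (R N).pair.isPreStep_num
            ((BiKummerSetting.mkOfConnectedTemperoidYddTower X tf hZ hP NH 𝒯 ιX).isPreStep_comp_aut (R N).pair.isPreStep_den ut)
            ((BiKummerSetting.mkOfConnectedTemperoidYddTower X tf hZ hP NH 𝒯 ιX).baseEquivalent_comp_unit (R N).pair.base_eq hut) ^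
            (N : ℕ) =
          pullFrac (D N).α₁
            ((BiKummerSetting.mkOfConnectedTemperoidYddTower X tf hZ hP NH 𝒯 ιX).fracOf (R 1).pair.num ((R 1).pair.den ≫ u₁.hom)
              (R 1).pair.isPreStep_num
              ((BiKummerSetting.mkOfConnectedTemperoidYddTower X tf hZ hP NH 𝒯 ιX).isPreStep_comp_aut (R 1).pair.isPreStep_den u₁)
              ((BiKummerSetting.mkOfConnectedTemperoidYddTower X tf hZ hP NH 𝒯 ιX).baseEquivalent_comp_unit (R 1).pair.base_eq
                hu₁)) ∧
        (BiKummerSetting.mkOfConnectedTemperoidYddTower X tf hZ hP NH 𝒯 ιX).IsSaturated (R N).AN N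
          (pullFrac (D N).α₁
            ((BiKummerSetting.mkOfConnectedTemperoidYddTower X tf hZ hP NH 𝒯 ιX).fracOf (R 1).pair.num ((R 1).pair.den ≫ u₁.hom)
              (R 1).pair.isPreStep_num
              ((BiKummerSetting.mkOfConnectedTemperoidYddTower X tf hZ hP NH 𝒯 ιX).isPreStep_comp_aut (R 1).pair.isPreStep_den u₁)
              ((BiKummerSetting.mkOfConnectedTemperoidYddTower X tf hZ hP NH 𝒯 ιX).baseEquivalent_comp_unit (R 1).pair.base_eq
                hu₁))))
    -- Prop. 4.2 (iv) at the `u₁`-twisted level-1 pair, per NORMALISED ANCHOR, ACROSS an isomorphism of pairs (repair (r4) of F-w6d077g6-1)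
    (hivPiso : ∀ (α₁ : h44.Ψ.functor.obj (R 1).AN ≅ (R 1).AN) (β₁ : h44.Ψ.functor.obj (R 1).BN ≅ (R 1).BN) (u₁ : Aut (R 1).BN)
      (hu₁ : u₁ ∈ (BiKummerSetting.mkOfConnectedTemperoidYddTower X tf hZ hP NH 𝒯 ιX).units (R 1).BN),
      α₁.inv ≫ h44.Ψ.functor.map (R 1).pair.num ≫ β₁.hom = (R 1).pair.num →
      α₁.inv ≫ h44.Ψ.functor.map (R 1).pair.den ≫ β₁.hom = (R 1).pair.den ≫ u₁.hom →
      ∀ c : K'ˣ, ModelFrobenioid.unit u₁.hom = (tf.ratFnFunctor.map (t 1).op).hom (c₀ c : tf.ratFnFunctor.obj (op X₀)) →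
      ∀ (N : ℕ+) {A₂ B₂ : (BiKummerSetting.mkOfConnectedTemperoidYddTower X tf hZ hP NH 𝒯 ιX).C}
      {f₂ : (BiKummerSetting.mkOfConnectedTemperoidYddTower X tf hZ hP NH 𝒯 ιX).biratUnits A₂}
      {P₂ : (BiKummerSetting.mkOfConnectedTemperoidYddTower X tf hZ hP NH 𝒯 ιX).FractionPair f₂ B₂}
      (R' : (BiKummerSetting.mkOfConnectedTemperoidYddTower X tf hZ hP NH 𝒯 ιX).NthRoot
        ((BiKummerSetting.mkOfConnectedTemperoidYddTower X tf hZ hP NH 𝒯 ιX).fracOf (R 1).pair.num ((R 1).pair.den ≫ u₁.hom)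
          (R 1).pair.isPreStep_num
          ((BiKummerSetting.mkOfConnectedTemperoidYddTower X tf hZ hP NH 𝒯 ιX).isPreStep_comp_aut (R 1).pair.isPreStep_den u₁)
          ((BiKummerSetting.mkOfConnectedTemperoidYddTower X tf hZ hP NH 𝒯 ιX).baseEquivalent_comp_unit (R 1).pair.base_eq hu₁))
        ((R 1).pair.twistUnit u₁ hu₁ rfl
          (BiKummerSetting.disjointSupports_twistUnit h.isDivisorial (R 1).pair u₁)) N pullFrac)
      (R₂ : (BiKummerSetting.mkOfConnectedTemperoidYddTower X tf hZ hP NH 𝒯 ιX).NthRoot f₂ P₂ N pullFrac)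
      (eA : A₂ ≅ (R 1).AN) (eB : B₂ ≅ (R 1).BN),
      eA.inv ≫ P₂.num ≫ eB.hom = (R 1).pair.num → eA.inv ≫ P₂.den ≫ eB.hom = (R 1).pair.den ≫ u₁.hom →
      pullFrac eA.hom
          ((BiKummerSetting.mkOfConnectedTemperoidYddTower X tf hZ hP NH 𝒯 ιX).fracOf (R 1).pair.num ((R 1).pair.den ≫ u₁.hom)
            (R 1).pair.isPreStep_num
            ((BiKummerSetting.mkOfConnectedTemperoidYddTower X tf hZ hP NH 𝒯 ιX).isPreStep_comp_aut (R 1).pair.isPreStep_den u₁)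
            ((BiKummerSetting.mkOfConnectedTemperoidYddTower X tf hZ hP NH 𝒯 ιX).baseEquivalent_comp_unit (R 1).pair.base_eq hu₁)) = f₂ →
      ∀ (ebs : (BiKummerSetting.mkOfConnectedTemperoidYddTower X tf hZ hP NH 𝒯 ιX).base.obj R'.AN ≅
        (BiKummerSetting.mkOfConnectedTemperoidYddTower X tf hZ hP NH 𝒯 ιX).base.obj R₂.AN),
      (BiKummerSetting.mkOfConnectedTemperoidYddTower X tf hZ hP NH 𝒯 ιX).base.map R'.α =
        ebs.hom ≫ (BiKummerSetting.mkOfConnectedTemperoidYddTower X tf hZ hP NH 𝒯 ιX).base.map (R₂.α ≫ eA.hom) →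
        ∃ (v : (BiKummerSetting.mkOfConnectedTemperoidYddTower X tf hZ hP NH 𝒯 ιX).mu R'.BN N) (ζA : R'.AN ≅ R₂.AN)
          (ζB : R'.BN ≅ R₂.BN),
          ζA.hom ≫ R₂.pair.num = R'.pair.num ≫ ζB.hom ∧
          ζA.hom ≫ R₂.pair.den = (R'.pair.den ≫ (v : Aut R'.BN).hom) ≫ ζB.hom ∧
          ζA.hom ≫ R₂.α ≫ eA.hom = R'.α ∧ ζB.hom ≫ R₂.β ≫ eB.hom = R'.β ∧
          (BiKummerSetting.mkOfConnectedTemperoidYddTower X tf hZ hP NH 𝒯 ιX).base.mapIso ζA = ebs) :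
    ∀ (α₁ : h44.Ψ.functor.obj (R 1).AN ≅ (R 1).AN) (β₁ : h44.Ψ.functor.obj (R 1).BN ≅ (R 1).BN) (u₁ : Aut (R 1).BN),
      u₁ ∈ (BiKummerSetting.mkOfConnectedTemperoidYddTower X tf hZ hP NH 𝒯 ιX).units (R 1).BN →
      α₁.inv ≫ h44.Ψ.functor.map (R 1).pair.num ≫ β₁.hom = (R 1).pair.num →
      α₁.inv ≫ h44.Ψ.functor.map (R 1).pair.den ≫ β₁.hom = (R 1).pair.den ≫ u₁.hom →
      ∀ c : K'ˣ, ModelFrobenioid.unit u₁.hom = (tf.ratFnFunctor.map (t 1).op).hom (c₀ c : tf.ratFnFunctor.obj (op X₀)) →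
        ∀ N : ℕ+, ∃ (a : h44.Ψ.functor.obj (R N).AN ≅ (R N).AN) (b : h44.Ψ.functor.obj (R N).BN ≅ (R N).BN)
          (w : Aut (R N).BN),
          w ∈ (BiKummerSetting.mkOfConnectedTemperoidYddTower X tf hZ hP NH 𝒯 ιX).units (R N).BN ∧
          a.inv ≫ h44.Ψ.functor.map (R N).pair.num ≫ b.hom = (R N).pair.num ∧
          a.inv ≫ h44.Ψ.functor.map (R N).pair.den ≫ b.hom = (R N).pair.den ≫ w.hom ∧
          a.inv ≫ h44.Ψ.functor.map (α (one_dvd_level N)) ≫ α₁.hom = α (one_dvd_level N) ∧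
          b.inv ≫ h44.Ψ.functor.map (β (one_dvd_level N)) ≫ β₁.hom = β (one_dvd_level N) := by
  intro α₁ β₁ u₁ hu₁ hnum hden c hux N
  have t1 : Objectwise (fun M _ => IsDivisorial M) (BiKummerSetting.mkOfConnectedTemperoidYddTower X tf hZ hP NH 𝒯 ιX).tf.divisorMonoid := h.isDivisorial
  have t3 : (BiKummerSetting.mkOfConnectedTemperoidYddTower X tf hZ hP NH 𝒯 ιX).IsIsometry (α (one_dvd_level N)) := isIsometry_α (one_dvd_level N)
  have t3b : (BiKummerSetting.mkOfConnectedTemperoidYddTower X tf hZ hP NH 𝒯 ιX).IsIsometry (β (one_dvd_level N)) := isIsometry_β (one_dvd_level N)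
  have hdega : (BiKummerSetting.mkOfConnectedTemperoidYddTower X tf hZ hP NH 𝒯 ιX).degFr (α (one_dvd_level N)) = N := degFr_eq_of_one_const (degFr_α (one_dvd_level N))
  have hdegb : (BiKummerSetting.mkOfConnectedTemperoidYddTower X tf hZ hP NH 𝒯 ιX).degFr (β (one_dvd_level N)) = N := degFr_eq_of_one_const (degFr_β (one_dvd_level N))
  obtain ⟨ut, hut, hover, hpow, hsat⟩ := hroot α₁ β₁ u₁ hu₁ hnum hden c hux N
  obtain ⟨ebs, hebsN⟩ := hebs α₁ N
  -- Prop. 4.2 (iv) across the anchor at the rebased root, fed in stages (elaboration budget)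
  have stage1 := BiKummerSetting.NthRoot.exists_coherent_family_member_rebase_iso h44 ψ pullFrac hpull hii h3 h4b h8 h15a h15
    (R N) (R 1) (α (one_dvd_level N)) (β (one_dvd_level N)) (comm_sCap (one_dvd_level N)) (comm_sCup (one_dvd_level N))
    t3 t3b hdega hdegb (D N) (hD N) u₁ hu₁ rfl (BiKummerSetting.disjointSupports_twistUnit t1 (R 1).pair u₁) α₁ β₁ hnum hden
  have stage2 := stage1 (hf α₁ β₁ u₁ hu₁ hnum hden c hux) ut hut hover rfl
    (BiKummerSetting.disjointSupports_twistUnit t1 (R N).pair ut) hpow hsat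
  obtain ⟨a', b', w, hw, -, h₁, h₂, h₃, h₄⟩ := stage2 (hivPiso α₁ β₁ u₁ hu₁ hnum hden c hux N) ebs hebsN
  exact ⟨a', b', w, hw, h₁, h₂, h₃, h₄⟩

include comm_sCap comm_sCup isIsometry_α degFr_α isIsometry_β degFr_β hpull hii h3 h4b h8 h15a h15 hD in
/-- **CONSTANT-ANCHORED twin** of abc-iut-w6-d077's `hfam_ofConnectedTemperoidFamily_of_rebase_anchored_iso` (tower currency: `(c : T.Kˣ)`, `unitsToBirat u₁ = constEmb 1 c`; `congrArg Units.val` reads it as `u_{u₁} = (t 1)^*(c₀ c)`) — the `hfam` binder of `…_ofConstAnchored_genuine_of_constantsDictionary` (`Sec5Thm57GenuineBindersAConstAnchor.lean`): **FILE 2 (anchored, r4) of the Thm. 5.7 final knit: the coherent family `hfam` of abc-iut-L2-d4's anchored capstone PRODUCED at the genuine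
connected tower WITHOUT `hArises`** (twin of abc-iut-f-123's `hfam_ofConnectedTemperoidFamily_of_rebase_anchored`, identical conclusion).
[cite: MochizukiEtTh2009, Thm 5.7 p.330 (PDF p.104); Rmk 4.3.2 p.318–319 (PDF pp.92–93); Prop 4.2 (iv) p.315 (PDF p.89)] -/
theorem hfam_ofConnectedTemperoidFamily_of_rebase_anchored_iso_const
    (T : ThetaFrobenioidTower.{w} (BiKummerSetting.mkOfConnectedTemperoidYddTower X tf hZ hP NH 𝒯 ιX).C
      (ConnectedPart (BTemp X.Pi)))
    (hT : T = ofConnectedTemperoidFamily h Q odd_l R ιX K' (fun N => (Units.map (tf.ratFnFunctor.map (t N).op).hom).comp c₀)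
      hinj hinvc hinvp α β comm_sCap comm_sCup isIsometry_α degFr_α isIsometry_β degFr_β baseFrob_α)

    -- per anchor: Thm. 4.4 (ii) birational compatibility of the anchor at `A_1` with the twisted fraction
    (hf : ∀ (α₁ : h44.Ψ.functor.obj (R 1).AN ≅ (R 1).AN) (β₁ : h44.Ψ.functor.obj (R 1).BN ≅ (R 1).BN) (u₁ : Aut (R 1).BN)
      (hu₁ : u₁ ∈ (BiKummerSetting.mkOfConnectedTemperoidYddTower X tf hZ hP NH 𝒯 ιX).units (R 1).BN),
      α₁.inv ≫ h44.Ψ.functor.map (R 1).pair.num ≫ β₁.hom = (R 1).pair.num →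
      α₁.inv ≫ h44.Ψ.functor.map (R 1).pair.den ≫ β₁.hom = (R 1).pair.den ≫ u₁.hom →
      ∀ c : K'ˣ, ModelFrobenioid.unit u₁.hom = (tf.ratFnFunctor.map (t 1).op).hom (c₀ c : tf.ratFnFunctor.obj (op X₀)) →
        pullFrac α₁.hom
          ((BiKummerSetting.mkOfConnectedTemperoidYddTower X tf hZ hP NH 𝒯 ιX).fracOf (R 1).pair.num ((R 1).pair.den ≫ u₁.hom)
            (R 1).pair.isPreStep_num
            ((BiKummerSetting.mkOfConnectedTemperoidYddTower X tf hZ hP NH 𝒯 ιX).isPreStep_comp_aut (R 1).pair.isPreStep_den u₁)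
            ((BiKummerSetting.mkOfConnectedTemperoidYddTower X tf hZ hP NH 𝒯 ιX).baseEquivalent_comp_unit (R 1).pair.base_eq hu₁)) =
          ψ (R 1).AN (R 1).root)
    -- per anchor and level: the base isomorphism of `Ψ` at `A_N` over `α_{1,N}` (⟸ «`A_N^bs` characteristic», p453958)
    (hebs : ∀ (α₁ : h44.Ψ.functor.obj (R 1).AN ≅ (R 1).AN) (N : ℕ+),
      ∃ ebs : (BiKummerSetting.mkOfConnectedTemperoidYddTower X tf hZ hP NH 𝒯 ιX).base.obj (R N).AN ≅
          (BiKummerSetting.mkOfConnectedTemperoidYddTower X tf hZ hP NH 𝒯 ιX).base.obj (h44.Ψ.functor.obj (R N).AN),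
        (BiKummerSetting.mkOfConnectedTemperoidYddTower X tf hZ hP NH 𝒯 ιX).base.map (α (one_dvd_level N)) =
          ebs.hom ≫ (BiKummerSetting.mkOfConnectedTemperoidYddTower X tf hZ hP NH 𝒯 ιX).base.map
            (h44.Ψ.functor.map (α (one_dvd_level N)) ≫ α₁.hom))
    -- per NORMALISED ANCHOR `(α₁, β₁, u₁)` and level (anchored form of abc-iut-L2-d4's `hroot₁N` with its birational clauses)
    (hroot : ∀ (α₁ : h44.Ψ.functor.obj (R 1).AN ≅ (R 1).AN) (β₁ : h44.Ψ.functor.obj (R 1).BN ≅ (R 1).BN) (u₁ : Aut (R 1).BN)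
      (hu₁ : u₁ ∈ (BiKummerSetting.mkOfConnectedTemperoidYddTower X tf hZ hP NH 𝒯 ιX).units (R 1).BN),
      α₁.inv ≫ h44.Ψ.functor.map (R 1).pair.num ≫ β₁.hom = (R 1).pair.num →
      α₁.inv ≫ h44.Ψ.functor.map (R 1).pair.den ≫ β₁.hom = (R 1).pair.den ≫ u₁.hom →
      ∀ c : K'ˣ, ModelFrobenioid.unit u₁.hom = (tf.ratFnFunctor.map (t 1).op).hom (c₀ c : tf.ratFnFunctor.obj (op X₀)) →
      ∀ (N : ℕ+), ∃ (ut : Aut (R N).BN) (hut : ut ∈ (BiKummerSetting.mkOfConnectedTemperoidYddTower X tf hZ hP NH 𝒯 ιX).units (R N).BN),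
        ut.hom ≫ β (one_dvd_level N) = β (one_dvd_level N) ≫ u₁.hom ∧
        (BiKummerSetting.mkOfConnectedTemperoidYddTower X tf hZ hP NH 𝒯 ιX).fracOf (R N).pair.num ((R N).pair.den ≫ ut.hom)
            (R N).pair.isPreStep_num
            ((BiKummerSetting.mkOfConnectedTemperoidYddTower X tf hZ hP NH 𝒯 ιX).isPreStep_comp_aut (R N).pair.isPreStep_den ut)
            ((BiKummerSetting.mkOfConnectedTemperoidYddTower X tf hZ hP NH 𝒯 ιX).baseEquivalent_comp_unit (R N).pair.base_eq hut) ^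
            (N : ℕ) =
          pullFrac (D N).α₁
            ((BiKummerSetting.mkOfConnectedTemperoidYddTower X tf hZ hP NH 𝒯 ιX).fracOf (R 1).pair.num ((R 1).pair.den ≫ u₁.hom)
              (R 1).pair.isPreStep_num
              ((BiKummerSetting.mkOfConnectedTemperoidYddTower X tf hZ hP NH 𝒯 ιX).isPreStep_comp_aut (R 1).pair.isPreStep_den u₁)
              ((BiKummerSetting.mkOfConnectedTemperoidYddTower X tf hZ hP NH 𝒯 ιX).baseEquivalent_comp_unit (R 1).pair.base_eq
                hu₁)) ∧
        (BiKummerSetting.mkOfConnectedTemperoidYddTower X tf hZ hP NH 𝒯 ιX).IsSaturated (R N).AN N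
          (pullFrac (D N).α₁
            ((BiKummerSetting.mkOfConnectedTemperoidYddTower X tf hZ hP NH 𝒯 ιX).fracOf (R 1).pair.num ((R 1).pair.den ≫ u₁.hom)
              (R 1).pair.isPreStep_num
              ((BiKummerSetting.mkOfConnectedTemperoidYddTower X tf hZ hP NH 𝒯 ιX).isPreStep_comp_aut (R 1).pair.isPreStep_den u₁)
              ((BiKummerSetting.mkOfConnectedTemperoidYddTower X tf hZ hP NH 𝒯 ιX).baseEquivalent_comp_unit (R 1).pair.base_eq
                hu₁))))
    -- Prop. 4.2 (iv) at the `u₁`-twisted level-1 pair, per NORMALISED ANCHOR, ACROSS an isomorphism of pairs (repair (r4) of F-w6d077g6-1)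
    (hivPiso : ∀ (α₁ : h44.Ψ.functor.obj (R 1).AN ≅ (R 1).AN) (β₁ : h44.Ψ.functor.obj (R 1).BN ≅ (R 1).BN) (u₁ : Aut (R 1).BN)
      (hu₁ : u₁ ∈ (BiKummerSetting.mkOfConnectedTemperoidYddTower X tf hZ hP NH 𝒯 ιX).units (R 1).BN),
      α₁.inv ≫ h44.Ψ.functor.map (R 1).pair.num ≫ β₁.hom = (R 1).pair.num →
      α₁.inv ≫ h44.Ψ.functor.map (R 1).pair.den ≫ β₁.hom = (R 1).pair.den ≫ u₁.hom →
      ∀ c : K'ˣ, ModelFrobenioid.unit u₁.hom = (tf.ratFnFunctor.map (t 1).op).hom (c₀ c : tf.ratFnFunctor.obj (op X₀)) →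
      ∀ (N : ℕ+) {A₂ B₂ : (BiKummerSetting.mkOfConnectedTemperoidYddTower X tf hZ hP NH 𝒯 ιX).C}
      {f₂ : (BiKummerSetting.mkOfConnectedTemperoidYddTower X tf hZ hP NH 𝒯 ιX).biratUnits A₂}
      {P₂ : (BiKummerSetting.mkOfConnectedTemperoidYddTower X tf hZ hP NH 𝒯 ιX).FractionPair f₂ B₂}
      (R' : (BiKummerSetting.mkOfConnectedTemperoidYddTower X tf hZ hP NH 𝒯 ιX).NthRoot
        ((BiKummerSetting.mkOfConnectedTemperoidYddTower X tf hZ hP NH 𝒯 ιX).fracOf (R 1).pair.num ((R 1).pair.den ≫ u₁.hom)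
          (R 1).pair.isPreStep_num
          ((BiKummerSetting.mkOfConnectedTemperoidYddTower X tf hZ hP NH 𝒯 ιX).isPreStep_comp_aut (R 1).pair.isPreStep_den u₁)
          ((BiKummerSetting.mkOfConnectedTemperoidYddTower X tf hZ hP NH 𝒯 ιX).baseEquivalent_comp_unit (R 1).pair.base_eq hu₁))
        ((R 1).pair.twistUnit u₁ hu₁ rfl
          (BiKummerSetting.disjointSupports_twistUnit h.isDivisorial (R 1).pair u₁)) N pullFrac)
      (R₂ : (BiKummerSetting.mkOfConnectedTemperoidYddTower X tf hZ hP NH 𝒯 ιX).NthRoot f₂ P₂ N pullFrac)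
      (eA : A₂ ≅ (R 1).AN) (eB : B₂ ≅ (R 1).BN),
      eA.inv ≫ P₂.num ≫ eB.hom = (R 1).pair.num → eA.inv ≫ P₂.den ≫ eB.hom = (R 1).pair.den ≫ u₁.hom →
      pullFrac eA.hom
          ((BiKummerSetting.mkOfConnectedTemperoidYddTower X tf hZ hP NH 𝒯 ιX).fracOf (R 1).pair.num ((R 1).pair.den ≫ u₁.hom)
            (R 1).pair.isPreStep_num
            ((BiKummerSetting.mkOfConnectedTemperoidYddTower X tf hZ hP NH 𝒯 ιX).isPreStep_comp_aut (R 1).pair.isPreStep_den u₁)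
            ((BiKummerSetting.mkOfConnectedTemperoidYddTower X tf hZ hP NH 𝒯 ιX).baseEquivalent_comp_unit (R 1).pair.base_eq hu₁)) = f₂ →
      ∀ (ebs : (BiKummerSetting.mkOfConnectedTemperoidYddTower X tf hZ hP NH 𝒯 ιX).base.obj R'.AN ≅
        (BiKummerSetting.mkOfConnectedTemperoidYddTower X tf hZ hP NH 𝒯 ιX).base.obj R₂.AN),
      (BiKummerSetting.mkOfConnectedTemperoidYddTower X tf hZ hP NH 𝒯 ιX).base.map R'.α =
        ebs.hom ≫ (BiKummerSetting.mkOfConnectedTemperoidYddTower X tf hZ hP NH 𝒯 ιX).base.map (R₂.α ≫ eA.hom) →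
        ∃ (v : (BiKummerSetting.mkOfConnectedTemperoidYddTower X tf hZ hP NH 𝒯 ιX).mu R'.BN N) (ζA : R'.AN ≅ R₂.AN)
          (ζB : R'.BN ≅ R₂.BN),
          ζA.hom ≫ R₂.pair.num = R'.pair.num ≫ ζB.hom ∧
          ζA.hom ≫ R₂.pair.den = (R'.pair.den ≫ (v : Aut R'.BN).hom) ≫ ζB.hom ∧
          ζA.hom ≫ R₂.α ≫ eA.hom = R'.α ∧ ζB.hom ≫ R₂.β ≫ eB.hom = R'.β ∧
          (BiKummerSetting.mkOfConnectedTemperoidYddTower X tf hZ hP NH 𝒯 ιX).base.mapIso ζA = ebs) :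
    ∀ (α₁ : h44.Ψ.functor.obj (T.AN 1) ≅ T.AN 1) (β₁ : h44.Ψ.functor.obj (T.BN 1) ≅ T.BN 1) (u₁ : Aut (T.BN 1))
      (hu₁ : u₁ ∈ (T.atLevel 1).units (T.BN 1)),
      α₁.inv ≫ h44.Ψ.functor.map (T.sCap 1) ≫ β₁.hom = T.sCap 1 →
      α₁.inv ≫ h44.Ψ.functor.map (T.sCup 1) ≫ β₁.hom = T.sCup 1 ≫ u₁.hom →
      ∀ c : T.Kˣ, (T.atLevel 1).unitsToBirat (T.BN 1) ⟨u₁, hu₁⟩ = T.constEmb 1 c →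
        ∀ N : ℕ+, ∃ (a : h44.Ψ.functor.obj (T.AN N) ≅ T.AN N) (b : h44.Ψ.functor.obj (T.BN N) ≅ T.BN N) (w : Aut (T.BN N)),
          w ∈ (T.atLevel N).units (T.BN N) ∧
          a.inv ≫ h44.Ψ.functor.map (T.sCap N) ≫ b.hom = T.sCap N ∧
          a.inv ≫ h44.Ψ.functor.map (T.sCup N) ≫ b.hom = T.sCup N ≫ w.hom ∧
          a.inv ≫ h44.Ψ.functor.map (T.α (one_dvd_level N)) ≫ α₁.hom = T.α (one_dvd_level N) ∧
          b.inv ≫ h44.Ψ.functor.map (T.β (one_dvd_level N)) ≫ β₁.hom = T.β (one_dvd_level N) := by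
  subst hT
  intro α₁ β₁ u₁ hu₁ hnum hden c hcst N
  exact hfam_of_rebase_anchored_iso_const 𝒯 ιX h R K' t c₀ α β comm_sCap comm_sCup isIsometry_α degFr_α isIsometry_β degFr_β h44 ψ
    hpull hii h3 h4b h8 h15a h15 D hD hf hebs hroot hivPiso α₁ β₁ u₁ hu₁ hnum hden c (congrArg Units.val hcst) N

end ThetaFrobenioidTower

end Literature.AnabelianGeometry.EtaleTheta

end
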